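/-
Copyright: the b2b-balaban T⁴-continuum CRUX team, row NE7b leaf lineage `t4-ne7b-formalise-leaf-04` (gen 147). Project licence.
-/
import Literature.Analysis.Calculus.LineRestrictionIteratedDeriv
import Mathlib.Analysis.Calculus.Deriv.Mul
import Mathlib.Analysis.Calculus.Deriv.Comp
import Mathlib.Analysis.Calculus.Deriv.Pow
import Mathlib.Analysis.Calculus.ContDiff.Operations

/-!
# THE HESSIAN OF THE SLAB EXPONENT `Φ(s,y) = W(y) + s·g(y) + (s²∕2)·h(y)` IN THE LETTERS OF `W, g, h`, and the slab display from a BLOCK display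
# with slack (row NE7b, node U5c; the supplier named NOT-HERE in `…NE7b.ConvexWindowVarianceMajorant` — [folklore] calculus, kernel theorems)

Cell `pub-balaban`, sub-cell `t4`, spine estimate NE7b (`T4WeightBudget.RelWeightBound`; the cell's OWN estimate — NOT PRINTED in [Bałaban 1983–89], NOT
PROVED).  Crux-route work under `Spine/NE7b/` (FREEZE (0) crux-prover clause) by leaf-04; NOTHING of Bałaban's is named, valued or asserted; no `def`; zero
`sorry`.  Imports: the tree's BUILT `Literature.Analysis.Calculus.LineRestrictionIteratedDeriv` and Mathlib only.

WHY.  `…NE7b.ConvexWindowVarianceMajorant` (Brascamp–Lieb in majorant form) consumes ONE letter: the slab convexity of the augmented exponent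
`Φ(s,y) = W y + s·g y + (s²∕2)·h y` on `Ioo (−r) r ×ˢ K`; by `…HessianFormFirstOrder` §1 (`Q = 0`) and `…ConvexWindowVarianceMajorant.convexOn_of_firstOrder`
that letter follows from the Hessian display `0 ≤ D²Φ(p)[w,w]` on the slab.  An instance holds its data as derivatives of `W, g, h` (in the road's reading
`W = V(x,·)`, `g = ∂ᵤV(x,·)`, `h` a chosen majorant), so it needs `D²Φ` IN THOSE LETTERS — §1–§2 — and a rule turning the BLOCK display AT `s = 0`,
`δ(σ² + ‖v‖²) ≤ σ²·h y + 2σ·Dg(y)v + D²W(y)[v,v]` on `K` (the Hessian-currency form of `[[h, ∇gᵀ],[∇g, D²W]] ≽ δ`), plus bounds on `D²g, Dh, D²h` over `K`,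
into the display on a slab of explicit half-width — §3.
WHAT IS PROVED ([folklore]): §1 `iteratedDeriv_two_slabLine` — for `W, g, h ∈ C²` on a real normed space,
`(d∕dt)²|₀ [W(y+tv) + (s+tσ)g(y+tv) + ((s+tσ)²∕2)h(y+tv)] = D²W(y)[v,v] + 2σ·Dg(y)v + s·D²g(y)[v,v] + σ²·h y + 2sσ·Dh(y)v + (s²∕2)·D²h(y)[v,v]`;
§2 `iteratedFDeriv_two_slab` — the same number IS `D²Φ(s,y)[(σ,v),(σ,v)]` (`iteratedFDeriv ℝ 2 Φ (s,y) (fun _ => (σ,v))`, the currency of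
`…HessianFormFirstOrder`); §3 `slab_hessian_nonneg_of_block` — block display with slack `δ > 0` on `K` and `|D²g(y)[v,v]| ≤ M‖v‖²`, `|Dh(y)v| ≤ M‖v‖`,
`|D²h(y)[v,v]| ≤ M‖v‖²` on `K` ⊢ `0 ≤ D²Φ(p)[w,w]` for `p ∈ Ioo (−r) r ×ˢ K`, any half-width `r ≤ 1` with `4rM ≤ δ` (`M ≥ 0`); §4 the dictionary for
JOINT data — for `V : E₁ × E₂ → ℝ` jointly `C²` and the sections `W = V(x,·)`, `g = DV(x,·)(u,0)`: `contDiff_fibreSection`, `contDiff(_two)_baseDerivSection`,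
`iteratedFDeriv_two_fibreSection` (`D²W(y)[v,v] = D²V(x,y)[(0,v),(0,v)]`), `fderiv_baseDerivSection` (`Dg(y)v = D²V(x,y)[(0,v),(u,0)]`).
NOT HERE (honest): the junction itself (`…HessianFormFirstOrder` has no hub olean at the time of writing — kernel-certified as a NOT-TO-FILE concat by this
lineage); which `W, g, h, δ, M` an instance of print displays ((A3)∕(A1c), programme-sized, NC-NE7b-α UNRULED); anything of Bałaban's.  BY-NAME EFFECT ON THE
WALL: NONE.  NE7b NOT PRINTED ∕ NOT PROVED; spine PROVED 0∕9; rung (B)+1 on a FINITE torus — NOT infinite volume, NOT the mass gap, NOT Clay.  HONEST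
DEPENDENCY: continuum YM on T⁴ ⇐ BetaPertH ∧ nine spine estimates (0/9 proved); BetaPertH ⇐ (D1) ∧ (D4) ∧ CAP+tail; G-an2-4 gates asym, D1 and NE2∕3∕4.
-/

set_option autoImplicit false

noncomputable section

open Set Filter Topology

namespace Summit.QuantumFields.BalabanUV.T4Continuum.NE7b.ConvexWindowSlabHessian

variable {E : Type*} [NormedAddCommGroup E] [NormedSpace ℝ E] {W g h : E → ℝ}

/-! ## §1 The second derivative of the slab exponent along a line, in the letters of `W, g, h` -/

/-- Line calculus for a `C²` function: `t ↦ F(y + t v)` is `C²`, its derivative at `t` is `DF(y + tv)v`, its derivative AT `0` is `DF(y)v`, and its second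
iterated derivative at `0` is `D²F(y)[v,v]`. [folklore] -/
theorem line_facts {F : E → ℝ} (hF : ContDiff ℝ 2 F) (y v : E) :
    ContDiff ℝ 2 (fun t : ℝ => F (y + t • v)) ∧ (∀ t : ℝ, HasDerivAt (fun t : ℝ => F (y + t • v)) (deriv (fun t : ℝ => F (y + t • v)) t) t) ∧
      deriv (fun t : ℝ => F (y + t • v)) 0 = fderiv ℝ F y v ∧
        HasDerivAt (deriv fun t : ℝ => F (y + t • v)) (iteratedFDeriv ℝ 2 F y fun _ => v) 0 := by
  have hc : ContDiff ℝ 2 (fun t : ℝ => F (y + t • v)) := Literature.Analysis.Calculus.contDiff_lineRestriction hF y v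
  have hd : ∀ t : ℝ, HasDerivAt (fun t : ℝ => F (y + t • v)) (fderiv ℝ F (y + t • v) v) t := fun t => by
    have hl : HasDerivAt (fun t : ℝ => y + t • v) v t := by simpa using ((hasDerivAt_id t).smul_const v).const_add y
    exact ((hF.differentiable (by norm_num)) (y + t • v)).hasFDerivAt.comp_hasDerivAt t hl
  refine ⟨hc, fun t => ((hc.differentiable (by norm_num)) t).hasDerivAt, by simpa using (hd 0).deriv, ?_⟩
  have h2 : HasDerivAt (deriv fun t : ℝ => F (y + t • v)) (deriv (deriv fun t : ℝ => F (y + t • v)) 0) 0 :=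
    (hc.differentiable_deriv_two 0).hasDerivAt
  have e : deriv (deriv fun t : ℝ => F (y + t • v)) 0 = iteratedFDeriv ℝ 2 F y fun _ => v := by
    have := Literature.Analysis.Calculus.iteratedDeriv_lineRestriction (n := 2) hF y v 0
    rw [zero_smul, add_zero] at this
    rw [← this, iteratedDeriv_succ, iteratedDeriv_one]
  rwa [e] at h2

/-- **THE SECOND LINE DERIVATIVE OF THE SLAB EXPONENT** (`W, g, h ∈ C²` on a real normed space; `s, σ ∈ ℝ`, `y, v ∈ E`):
`(d∕dt)²|₀ [W(y+tv) + (s+tσ)·g(y+tv) + ((s+tσ)²∕2)·h(y+tv)] = D²W(y)[v,v] + 2σ·Dg(y)v + s·D²g(y)[v,v] + σ²·h y + 2sσ·Dh(y)v + (s²∕2)·D²h(y)[v,v]`. [folklore] -/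
theorem iteratedDeriv_two_slabLine (hW : ContDiff ℝ 2 W) (hg : ContDiff ℝ 2 g) (hh : ContDiff ℝ 2 h) (s σ : ℝ) (y v : E) :
    iteratedDeriv 2 (fun t : ℝ => W (y + t • v) + (s + t * σ) * g (y + t • v) + (s + t * σ) ^ 2 / 2 * h (y + t • v)) 0 =
      iteratedFDeriv ℝ 2 W y (fun _ => v) + 2 * σ * fderiv ℝ g y v + s * iteratedFDeriv ℝ 2 g y (fun _ => v) + σ ^ 2 * h y +
        2 * s * σ * fderiv ℝ h y v + s ^ 2 / 2 * iteratedFDeriv ℝ 2 h y (fun _ => v) := by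
  obtain ⟨_, hWd, hW0, hW2⟩ := line_facts hW y v
  obtain ⟨hgc, hgd, hg0, hg2⟩ := line_facts hg y v
  obtain ⟨hhc, hhd, hh0, hh2⟩ := line_facts hh y v
  -- the affine factor and its square
  have ha : ∀ t : ℝ, HasDerivAt (fun t : ℝ => s + t * σ) σ t := fun t => by
    simpa using ((hasDerivAt_id t).mul_const σ).const_add s
  have ha2 : ∀ t : ℝ, HasDerivAt (fun t : ℝ => (s + t * σ) ^ 2 / 2) ((s + t * σ) * σ) t := fun t => by
    have := ((ha t).pow 2).div_const 2
    exact this.congr_deriv (by ring)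
  -- first derivative, as a function of `t`
  have h1 : ∀ t : ℝ, HasDerivAt (fun t : ℝ => W (y + t • v) + (s + t * σ) * g (y + t • v) + (s + t * σ) ^ 2 / 2 * h (y + t • v))
      (deriv (fun t : ℝ => W (y + t • v)) t + (σ * g (y + t • v) + (s + t * σ) * deriv (fun t : ℝ => g (y + t • v)) t) +
        ((s + t * σ) * σ * h (y + t • v) + (s + t * σ) ^ 2 / 2 * deriv (fun t : ℝ => h (y + t • v)) t)) t := fun t =>
    ((hWd t).add ((ha t).mul (hgd t))).add ((ha2 t).mul (hhd t))
  have hderiv : deriv (fun t : ℝ => W (y + t • v) + (s + t * σ) * g (y + t • v) + (s + t * σ) ^ 2 / 2 * h (y + t • v)) = fun t =>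
      deriv (fun t : ℝ => W (y + t • v)) t + (σ * g (y + t • v) + (s + t * σ) * deriv (fun t : ℝ => g (y + t • v)) t) +
        ((s + t * σ) * σ * h (y + t • v) + (s + t * σ) ^ 2 / 2 * deriv (fun t : ℝ => h (y + t • v)) t) := funext fun t => (h1 t).deriv
  -- second derivative at `0`
  have hb : HasDerivAt (fun t : ℝ => (s + t * σ) * σ) (σ * σ) 0 := by simpa using (ha 0).mul_const σ
  have h2 : HasDerivAt (fun t : ℝ =>
      deriv (fun t : ℝ => W (y + t • v)) t + (σ * g (y + t • v) + (s + t * σ) * deriv (fun t : ℝ => g (y + t • v)) t) +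
        ((s + t * σ) * σ * h (y + t • v) + (s + t * σ) ^ 2 / 2 * deriv (fun t : ℝ => h (y + t • v)) t)) _ 0 :=
    (hW2.add (((hgd 0).const_mul σ).add ((ha 0).mul hg2))).add ((hb.mul (hhd 0)).add ((ha2 0).mul hh2))
  rw [iteratedDeriv_succ, iteratedDeriv_one, hderiv, h2.deriv, hg0, hh0]
  simp only [zero_mul, add_zero, zero_smul]
  ring

/-! ## §2 The same number is the Hessian of `Φ` on `ℝ × E` -/

/-- The slab exponent `Φ(p) = W p.2 + p.1·g p.2 + (p.1²∕2)·h p.2` is `C²` on `ℝ × E` for `W, g, h ∈ C²`. [folklore] -/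
theorem contDiff_slab (hW : ContDiff ℝ 2 W) (hg : ContDiff ℝ 2 g) (hh : ContDiff ℝ 2 h) :
    ContDiff ℝ 2 (fun p : ℝ × E => W p.2 + p.1 * g p.2 + p.1 ^ 2 / 2 * h p.2) :=
  ((hW.comp contDiff_snd).add (contDiff_fst.mul (hg.comp contDiff_snd))).add (((contDiff_fst.pow 2).div_const 2).mul (hh.comp contDiff_snd))

/-- **THE HESSIAN OF THE SLAB EXPONENT IN THE LETTERS OF `W, g, h`**: for `W, g, h ∈ C²`,
`D²Φ(s,y)[(σ,v),(σ,v)] = D²W(y)[v,v] + 2σ·Dg(y)v + s·D²g(y)[v,v] + σ²·h y + 2sσ·Dh(y)v + (s²∕2)·D²h(y)[v,v]`. [folklore] -/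
theorem iteratedFDeriv_two_slab (hW : ContDiff ℝ 2 W) (hg : ContDiff ℝ 2 g) (hh : ContDiff ℝ 2 h) (s σ : ℝ) (y v : E) :
    iteratedFDeriv ℝ 2 (fun p : ℝ × E => W p.2 + p.1 * g p.2 + p.1 ^ 2 / 2 * h p.2) (s, y) (fun _ => (σ, v)) =
      iteratedFDeriv ℝ 2 W y (fun _ => v) + 2 * σ * fderiv ℝ g y v + s * iteratedFDeriv ℝ 2 g y (fun _ => v) + σ ^ 2 * h y +
        2 * s * σ * fderiv ℝ h y v + s ^ 2 / 2 * iteratedFDeriv ℝ 2 h y (fun _ => v) := by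
  have key := Literature.Analysis.Calculus.iteratedDeriv_lineRestriction (n := 2) (contDiff_slab hW hg hh) (s, y) (σ, v) 0
  rw [zero_smul, add_zero] at key
  rw [← key, ← iteratedDeriv_two_slabLine hW hg hh s σ y v]
  congr 1

/-! ## §3 The slab display from a block display with slack -/

/-- **THE SLAB DISPLAY FROM THE BLOCK DISPLAY AT `s = 0`**: if on `K` the block form dominates with slack,
`δ(σ² + ‖v‖²) ≤ D²W(y)[v,v] + 2σ·Dg(y)v + σ²·h y` (all `σ, v`), and `|D²g(y)[v,v]| ≤ M‖v‖²`, `|Dh(y)v| ≤ M‖v‖`, `|D²h(y)[v,v]| ≤ M‖v‖²` on `K`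
(`M ≥ 0`), then for every half-width `r ≤ 1` with `4rM ≤ δ`: `0 ≤ D²Φ(p)[w,w]` for all `p ∈ Ioo (−r) r ×ˢ K` and all `w`. [folklore] -/
theorem slab_hessian_nonneg_of_block (hW : ContDiff ℝ 2 W) (hg : ContDiff ℝ 2 g) (hh : ContDiff ℝ 2 h) {K : Set E} {δ M r : ℝ}
    (hM : 0 ≤ M) (hr1 : r ≤ 1) (hrM : 4 * r * M ≤ δ)
    (hblock : ∀ y ∈ K, ∀ (σ : ℝ) (v : E), δ * (σ ^ 2 + ‖v‖ ^ 2) ≤ iteratedFDeriv ℝ 2 W y (fun _ => v) + 2 * σ * fderiv ℝ g y v + σ ^ 2 * h y)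
    (hg2 : ∀ y ∈ K, ∀ v : E, |iteratedFDeriv ℝ 2 g y (fun _ => v)| ≤ M * ‖v‖ ^ 2) (hh1 : ∀ y ∈ K, ∀ v : E, |fderiv ℝ h y v| ≤ M * ‖v‖)
    (hh2 : ∀ y ∈ K, ∀ v : E, |iteratedFDeriv ℝ 2 h y (fun _ => v)| ≤ M * ‖v‖ ^ 2) :
    ∀ p ∈ Ioo (-r) r ×ˢ K, ∀ w : ℝ × E, 0 ≤ iteratedFDeriv ℝ 2 (fun p : ℝ × E => W p.2 + p.1 * g p.2 + p.1 ^ 2 / 2 * h p.2) p (fun _ => w) := by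
  rintro ⟨s, y⟩ ⟨hs, hy⟩ ⟨σ, v⟩
  rw [iteratedFDeriv_two_slab hW hg hh s σ y v]
  have hs' : |s| ≤ r := (abs_lt.2 ⟨hs.1, hs.2⟩).le
  have hr0 : 0 ≤ r := (abs_nonneg s).trans hs'
  have hs1 : |s| ≤ 1 := hs'.trans hr1
  have hb := hblock y hy σ v
  have hv2 : 0 ≤ ‖v‖ ^ 2 := by positivity
  have hσ2 : 0 ≤ σ ^ 2 := sq_nonneg σ
  -- the three perturbation terms are small
  have e1 : |s * iteratedFDeriv ℝ 2 g y (fun _ => v)| ≤ r * (M * ‖v‖ ^ 2) := by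
    rw [abs_mul]; exact mul_le_mul hs' (hg2 y hy v) (abs_nonneg _) hr0
  have e2 : |2 * s * σ * fderiv ℝ h y v| ≤ r * (2 * (|σ| * (M * ‖v‖))) := by
    calc |2 * s * σ * fderiv ℝ h y v| = |s| * (2 * (|σ| * |fderiv ℝ h y v|)) := by
          rw [abs_mul, abs_mul, abs_mul, abs_two]; ring
      _ ≤ r * (2 * (|σ| * (M * ‖v‖))) :=
          mul_le_mul hs' (mul_le_mul_of_nonneg_left (mul_le_mul_of_nonneg_left (hh1 y hy v) (abs_nonneg σ)) (by norm_num))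
            (by positivity) hr0
  have e3 : |s ^ 2 / 2 * iteratedFDeriv ℝ 2 h y (fun _ => v)| ≤ r / 2 * (M * ‖v‖ ^ 2) := by
    rw [abs_mul]
    refine mul_le_mul ?_ (hh2 y hy v) (abs_nonneg _) (by positivity)
    rw [abs_of_nonneg (by positivity), ← sq_abs]
    nlinarith [abs_nonneg s]
  -- `2|σ|·M‖v‖ ≤ M(σ² + ‖v‖²)`
  have hyoung : 2 * (|σ| * (M * ‖v‖)) ≤ M * (σ ^ 2 + ‖v‖ ^ 2) := by
    nlinarith [sq_nonneg (|σ| - ‖v‖), sq_abs σ, abs_nonneg σ, norm_nonneg v]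
  have f1 : r * (M * ‖v‖ ^ 2) ≤ δ / 4 * ‖v‖ ^ 2 := by nlinarith
  have f2 : r * (2 * (|σ| * (M * ‖v‖))) ≤ δ / 4 * (σ ^ 2 + ‖v‖ ^ 2) :=
    (mul_le_mul_of_nonneg_left hyoung hr0).trans (by nlinarith)
  have f3 : r / 2 * (M * ‖v‖ ^ 2) ≤ δ / 8 * ‖v‖ ^ 2 := by nlinarith
  have hδ : 0 ≤ δ := le_trans (by positivity) hrM
  linarith [neg_abs_le (s * iteratedFDeriv ℝ 2 g y (fun _ => v)), neg_abs_le (2 * s * σ * fderiv ℝ h y v),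
    neg_abs_le (s ^ 2 / 2 * iteratedFDeriv ℝ 2 h y (fun _ => v)), mul_nonneg hδ hσ2, mul_nonneg hδ hv2]


/-! ## §4 Sections of a jointly `C²` exponent: the dictionary for JOINT block displays

In the road's reading `W = V(x,·)` and `g = ∂ᵤV(x,·)` are SECTIONS of a jointly `C²` exponent `V : E₁ × E₂ → ℝ`; an instance displaying the
JOINT block Hessian of `V` at `(x,y)` reads §3's letters through: `D²W(y)[v,v] = D²V(x,y)[(0,v),(0,v)]` and `Dg(y)v = D²V(x,y)[(0,v),(u,0)]`. -/

section Sections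

variable {E₁ E₂ : Type*} [NormedAddCommGroup E₁] [NormedSpace ℝ E₁] [NormedAddCommGroup E₂] [NormedSpace ℝ E₂] {V : E₁ × E₂ → ℝ}

/-- A fibre section of a `Cⁿ` function is `Cⁿ`. [folklore] -/
theorem contDiff_fibreSection {N : WithTop ℕ∞} (hV : ContDiff ℝ N V) (x : E₁) : ContDiff ℝ N fun y : E₂ => V (x, y) :=
  hV.comp (contDiff_const.prodMk contDiff_id)

/-- The base-derivative section `y ↦ DV(x,y)(u,0)` of a `C²` function is `C¹` (and `C²` for `V ∈ C³`, by the same term with `3`). [folklore] -/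
theorem contDiff_baseDerivSection (hV : ContDiff ℝ 2 V) (x u : E₁) : ContDiff ℝ 1 fun y : E₂ => fderiv ℝ V (x, y) (u, 0) :=
  ((hV.fderiv_right (m := 1) (by norm_num)).comp (contDiff_const.prodMk contDiff_id)).clm_apply contDiff_const

/-- For `V ∈ C³` the base-derivative section is `C²` — the regularity §3 asks of `g`. [folklore] -/
theorem contDiff_two_baseDerivSection (hV : ContDiff ℝ 3 V) (x u : E₁) : ContDiff ℝ 2 fun y : E₂ => fderiv ℝ V (x, y) (u, 0) :=
  ((hV.fderiv_right (m := 2) (by norm_num)).comp (contDiff_const.prodMk contDiff_id)).clm_apply contDiff_const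

/-- **FIBRE HESSIAN OF THE SECTION = JOINT HESSIAN ON FIBRE DIRECTIONS**: `D²(V(x,·))(y)[v,v] = D²V(x,y)[(0,v),(0,v)]` (`V ∈ C²`). [folklore] -/
theorem iteratedFDeriv_two_fibreSection (hV : ContDiff ℝ 2 V) (x : E₁) (y v : E₂) :
    iteratedFDeriv ℝ 2 (fun y : E₂ => V (x, y)) y (fun _ => v) = iteratedFDeriv ℝ 2 V (x, y) (fun _ => ((0 : E₁), v)) := by
  have h1 := Literature.Analysis.Calculus.iteratedDeriv_lineRestriction (n := 2) (contDiff_fibreSection hV x) y v 0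
  have h2 := Literature.Analysis.Calculus.iteratedDeriv_lineRestriction (n := 2) hV (x, y) ((0 : E₁), v) 0
  rw [zero_smul, add_zero] at h1 h2
  rw [← h1, ← h2]
  congr 1
  funext t
  simp

/-- **FIBRE DERIVATIVE OF THE BASE-DERIVATIVE SECTION = MIXED JOINT HESSIAN**: `D(y ↦ DV(x,y)(u,0))(y)v = D²V(x,y)[(0,v),(u,0)]`
(`= fderiv ℝ (fderiv ℝ V) (x,y) (0,v) (u,0)`; `V ∈ C²`). [folklore] -/
theorem fderiv_baseDerivSection (hV : ContDiff ℝ 2 V) (x u : E₁) (y v : E₂) :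
    fderiv ℝ (fun y : E₂ => fderiv ℝ V (x, y) (u, 0)) y v = iteratedFDeriv ℝ 2 V (x, y) ![((0 : E₁), v), (u, (0 : E₂))] := by
  have hF : HasFDerivAt (fderiv ℝ V) (fderiv ℝ (fderiv ℝ V) (x, y)) (x, y) :=
    (((hV.fderiv_right (m := 1) (by norm_num)).differentiable (by norm_num)) (x, y)).hasFDerivAt
  have hG := hF.clm_apply (hasFDerivAt_const ((u, (0 : E₂)) : E₁ × E₂) (x, y))
  have hmk : HasFDerivAt (fun y : E₂ => ((x, y) : E₁ × E₂)) (ContinuousLinearMap.inr ℝ E₁ E₂) y := hasFDerivAt_prodMk_right x y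
  have hc := hG.comp y hmk
  have e : (fun y : E₂ => fderiv ℝ V (x, y) (u, 0)) = (fun p : E₁ × E₂ => fderiv ℝ V p (u, 0)) ∘ fun y : E₂ => ((x, y) : E₁ × E₂) := rfl
  rw [e, hc.fderiv, iteratedFDeriv_two_apply]
  simp

end Sections

end Summit.QuantumFields.BalabanUV.T4Continuum.NE7b.ConvexWindowSlabHessian
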